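/-
Copyright (c) 2026 the pub-hodgecm-mathlib formalisation cell (harness21).  Prover seat hodgecm-mathlib-F0P3a-p03 (g25): N8-INNER road, brick (10)(C′)
«CORNER EP PACKAGE», FILE F-D′ (the one-place, measure-generic corollary of the corner generator — the `hEP` currency).
-/
import Literature.NumberTheory.Rogawski1990.ArchEPGeneratorCorner             -- ★ F-D (this seat): `epGeneratorAt_scalar_corner` (family block)
import Literature.NumberTheory.Automorphic.UnitaryGroupArchUnimodular        -- ★ `modularCharacterFun_archLocal_eq_one` (the local unitary groups are unimodular)
import Literature.NumberTheory.Automorphic.ArchChartOrbHaarScaling            -- ★ `isHaarMeasure_prodConventionG`, `isMulRightInvariant_prodConventionG` (the product convention)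
import Literature.NumberTheory.Automorphic.GLnAdelicIntegrationFactsProofs  -- ★ `isMulRightInvariant_of_modularCharacterFun_eq_one`
import HarnessLib

/-!
# The scalar-corner one-place EP generator at ONE place with ANY Haar measure (N8-INNER brick (10)(C′), FILE F-D′)

Topic `NumberTheory/Rogawski1990`; namespace `Literature.NumberTheory.Rogawski1990`.  THEOREMS ONLY (no `def`, no instance, no notation, no axiom, no named
fact, no `sorry`); kernel lane `--supports stmt-HodgeConjecture-24833`.  Cell `pub/hodgecm-mathlib`, crux H413; road N8-INNER (owner LH2-plan (g1)), brick (10)(C′)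
«CORNER EP PACKAGE» (F0P3a-p03 (g25)); the dealer's 17:30:57Z ask «export the ONE-PLACE corollary» (ref5 R-781).  Count-neutral.

★ `epGeneratorAt_scalar_corner` concludes `EPGeneratorAt L β₀ w (ν′_w w) (esymm3 (ζ,ζ,ζ))` inside the product-measure block of ★ (J) (Borel structures and right-invariant
Haar measures at ALL complex places, a global `ν′ = e⁻¹_* ⊗ ν′_v`).  The EP assembly binds `hEP` at ONE place with an arbitrary Borel structure and Haar measure `ν_w`; this
file supplies exactly that: **`epGeneratorAt_scalar_corner_onePlace (w) [MeasurableSpace] [BorelSpace] (νw) [IsHaarMeasure] [IsMulRightInvariant] (ζ) :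
EPGeneratorAt L β₀ w νw (esymm3 fun _ => ζ)`**, by choosing a product convention THROUGH `ν_w` (Borel at the other places, `Function.update (fun v => haar) w ν_w`,
right-invariance at `v ≠ w` by unimodularity) — no mathematics, instance bookkeeping only.
HONEST LABEL: HC_CM is proved only modulo the 7 printed citations (2 remaining: hLiu418 = `stmt-HodgeConjecture-24832`, h413 = `stmt-HodgeConjecture-24833`) until rung 0 closes.

## References
* [Rogawski1990] J. D. Rogawski, *Automorphic Representations of Unitary Groups in Three Variables*, Ann. of Math. Stud. 123 (1990), §8.2 p. 122, §8.4 pp. 126–127.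
* [BorelJacquet1979] A. Borel, H. Jacquet, *Automorphic forms and automorphic representations*, PSPM 33.1 (1979), §4.1.
* [Knapp2002] A. W. Knapp, *Lie Groups Beyond an Introduction*, 2nd ed. (2002), VIII §2 Cor. 8.31 (reductive groups are unimodular).
-/

set_option autoImplicit false

noncomputable section

open MeasureTheory MeasureTheory.Measure NumberField NumberField.InfinitePlace Matrix Complex Set Filter Topology Function Metric
open scoped MatrixGroups Matrix Real Classical ENNReal NNReal ContDiff
open Literature.NumberTheory.Automorphic Literature.NumberTheory.Automorphic.UnitaryGroup Literature.NumberTheory.Automorphic.ArchCartan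

namespace Literature.NumberTheory.Rogawski1990

/-! ## The one-place, measure-generic corollary -/

section OnePlace

variable (L : Type) [Field L] [NumberField L] [IsCMField L]

/-- Transport of ★ `EPGeneratorAt` along an equality of one-place measures (the head takes its Haar instances as arguments; they are propositions).
[cite: Rogawski1990, §8.2 p. 122] -/
theorem EPGeneratorAt.of_measure_eq (α : Fin 3 → L) (w : {w : InfinitePlace L // IsComplex w})
    [MeasurableSpace ↥(archLocal L 3 (Matrix.diagonal α) w)] [BorelSpace ↥(archLocal L 3 (Matrix.diagonal α) w)]
    {νw νw' : Measure ↥(archLocal L 3 (Matrix.diagonal α) w)} [νw.IsHaarMeasure] [νw.IsMulRightInvariant] [νw'.IsHaarMeasure] [νw'.IsMulRightInvariant]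
    (h : νw' = νw) {b : ℂ × ℂ × ℂ} (hb : EPGeneratorAt L α w νw' b) : EPGeneratorAt L α w νw b := by
  subst h
  exact hb

/-- **THE SCALAR-CORNER ONE-PLACE EP GENERATOR — ONE PLACE, ANY BOREL STRUCTURE, ANY HAAR MEASURE** (the form the EP assembly binds as `hEP`): for every complex place `w`, every
right-invariant Haar measure `ν_w` on `U(β₀)_w` and every `ζ ∈ S¹`, `EPGeneratorAt L β₀ w ν_w (esymm3 (ζ,ζ,ζ))`.  From ★ `epGeneratorAt_scalar_corner` by CHOOSING a product
convention through `ν_w`: Borel structures at the other places, the dependent family `Function.update (fun v => haar) w ν_w` (right-invariant at `v ≠ w` because the local unitary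
groups are unimodular, ★ `modularCharacterFun_archLocal_eq_one`), and `ν′ := e⁻¹_* ⊗_v ν′_v` (★ `isHaarMeasure_prodConventionG`, ★ `isMulRightInvariant_prodConventionG`); the head
reads the place `w` only. [cite: Rogawski1990, §8.2 p. 122; §8.4 pp. 126–127] [cite: BorelJacquet1979, §4.1] [cite: Knapp2002, VIII.§2 Cor. 8.31] -/
theorem epGeneratorAt_scalar_corner_onePlace (w : {w : InfinitePlace L // IsComplex w})
    [MeasurableSpace ↥(archLocal L 3 (Matrix.diagonal ![(2 : L)⁻¹, 1, -(2 : L)⁻¹]) w)] [BorelSpace ↥(archLocal L 3 (Matrix.diagonal ![(2 : L)⁻¹, 1, -(2 : L)⁻¹]) w)]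
    (νw : Measure ↥(archLocal L 3 (Matrix.diagonal ![(2 : L)⁻¹, 1, -(2 : L)⁻¹]) w)) [νw.IsHaarMeasure] [νw.IsMulRightInvariant] (ζ : Circle) :
    EPGeneratorAt L ![(2 : L)⁻¹, 1, -(2 : L)⁻¹] w νw (esymm3 fun _ : Fin 3 => (ζ : ℂ)) := by
  -- the given Borel structure at `w` IS `borel`
  obtain ⟨hmeas⟩ := ‹BorelSpace ↥(archLocal L 3 (Matrix.diagonal ![(2 : L)⁻¹, 1, -(2 : L)⁻¹]) w)›
  subst hmeas
  -- Borel structures everywhere, local compactness, the Haar family through `νw`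
  letI mS : ∀ v : {w : InfinitePlace L // IsComplex w}, MeasurableSpace ↥(archLocal L 3 (Matrix.diagonal ![(2 : L)⁻¹, 1, -(2 : L)⁻¹]) v) := fun v => borel _
  haveI : ∀ v : {w : InfinitePlace L // IsComplex w}, BorelSpace ↥(archLocal L 3 (Matrix.diagonal ![(2 : L)⁻¹, 1, -(2 : L)⁻¹]) v) := fun v => ⟨rfl⟩
  haveI : ∀ v : {w : InfinitePlace L // IsComplex w}, LocallyCompactSpace ↥(archLocal L 3 (Matrix.diagonal ![(2 : L)⁻¹, 1, -(2 : L)⁻¹]) v) :=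
    fun v => locallyCompactSpace_archLocal_three L ![(2 : L)⁻¹, 1, -(2 : L)⁻¹] v
  haveI : ∀ v : {w : InfinitePlace L // IsComplex w}, SecondCountableTopology ↥(archLocal L 3 (Matrix.diagonal ![(2 : L)⁻¹, 1, -(2 : L)⁻¹]) v) :=
    fun v => secondCountableTopology_archLocal_three L ![(2 : L)⁻¹, 1, -(2 : L)⁻¹] v
  set ν'w : ∀ v : {w : InfinitePlace L // IsComplex w}, Measure ↥(archLocal L 3 (Matrix.diagonal ![(2 : L)⁻¹, 1, -(2 : L)⁻¹]) v) :=
    Function.update (fun v => MeasureTheory.Measure.haar) w νw with hν'w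
  have hw : ν'w w = νw := by rw [hν'w, Function.update_self]
  have hherm := transpose_map_cmConjRingHom_diagonal_quasiSplitWeights L
  have hdet : (Matrix.diagonal ![(2 : L)⁻¹, 1, -(2 : L)⁻¹]).det ≠ 0 := by
    rw [Matrix.det_diagonal]
    exact Finset.prod_ne_zero_iff.2 fun i _ => quasiSplitWeights_ne_zero L i
  haveI : ∀ v, (ν'w v).IsHaarMeasure := by
    intro v
    by_cases hv : v = w
    · subst hv; rw [hw]; infer_instance
    · rw [hν'w, Function.update_of_ne hv]; infer_instance
  haveI : ∀ v, (ν'w v).IsMulRightInvariant := by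
    intro v
    by_cases hv : v = w
    · subst hv; rw [hw]; infer_instance
    · rw [hν'w, Function.update_of_ne hv]
      exact Literature.NumberTheory.Automorphic.isMulRightInvariant_of_modularCharacterFun_eq_one
        (modularCharacterFun_archLocal_eq_one L (Matrix.diagonal ![(2 : L)⁻¹, 1, -(2 : L)⁻¹]) hherm hdet v) _
  -- the product convention
  letI : MeasurableSpace ↥(arch (↥(maximalRealSubfield L)) L (IsCMField.complexConj L) 3 (Matrix.diagonal ![(2 : L)⁻¹, 1, -(2 : L)⁻¹])) := borel _
  haveI : BorelSpace ↥(arch (↥(maximalRealSubfield L)) L (IsCMField.complexConj L) 3 (Matrix.diagonal ![(2 : L)⁻¹, 1, -(2 : L)⁻¹])) := ⟨rfl⟩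
  haveI := isHaarMeasure_prodConventionG L ![(2 : L)⁻¹, 1, -(2 : L)⁻¹] ν'w
  haveI := isMulRightInvariant_prodConventionG L ![(2 : L)⁻¹, 1, -(2 : L)⁻¹] ν'w
  have h := epGeneratorAt_scalar_corner L ν'w ((Measure.pi ν'w).map (archPiEquivCM 3 L (Matrix.diagonal ![(2 : L)⁻¹, 1, -(2 : L)⁻¹])).symm) rfl w ζ
  exact EPGeneratorAt.of_measure_eq L ![(2 : L)⁻¹, 1, -(2 : L)⁻¹] w hw h

end OnePlace

end Literature.NumberTheory.Rogawski1990

end
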